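import Literature.Topology.FourManifolds.SeifertHypersurfaceLevel
import HarnessLib

/-!
# Seifert hypersurfaces in codimension two, II: the hypersurface `M ∪ θ⁻¹{v}` bounds `M`
# (Kirby 1989, VIII Thm. 3, geometric half)

Topic `Literature/Topology/FourManifolds`; fact seat
`provefact-Literature.Topology.FourManifolds.isOrientedBordant_of_isEmpty_of_signature_eq_zero`
(Kirby, *The Topology of 4-Manifolds* (1989), Cor. IX.2 via VIII Thm 1(A), whose last step is
VIII **Thm 3**, pp. 44–45: *"`Nⁿ ⊂ Qⁿ⁺²` closed with trivial normal bundle and `[N] = 0` bounds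
a compact `Vⁿ⁺¹ ⊂ Q`"*, `V = f_α⁻¹(p) ∪ N` for a circle-valued `f_α` transverse to `p`).  Sequel of
`SeifertHypersurfaceLevel.lean`, porting the tree's `SeifertSurfaceClosure.lean` (Juhász 2023,
proof of Prop. 4.10, `n = 1`) to every dimension.  Everything here is **proved**; no named fact
is introduced.

From part I: for a Seifert hypersurface datum `D` of a codimension-two framed tubular embedding
`E` of the compact `n`-manifold `M` into `Sⁿ⁺²` (circle map `θ`, regular value `v` with regular
antipode) the closed-up level hypersurface `Λ = M ∪ θ⁻¹{±v}` is a compact orientable `C^∞`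
`(n+1)`-manifold without boundary (`D.Sheet`, points read in the sphere by `D.pt`).  Here:

* **the side function** `τ : Λ → ℝ` (`sideFn`): `-sat ⟪w, v⟫` in the unit tube (`sat` the
  tree's smooth saturation of the identity) and `∓1` on the two sheets `θ⁻¹{±v}` away from `M`;
  smooth, `{τ = 0} = M`, `{τ ≤ 0} = M ∪ θ⁻¹{v}`, and `0` is a regular value (along the radial
  curve `s ↦ tube (x, (sat s / 2) v)` through a point of `M`, `τ` reads `-s/2`);
* **the Seifert hypersurface** `V = {τ ≤ 0}` (`Hypersurface`, the tree's `RegularSublevel` of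
  `RegularLevelSplitting.lean`, Milnor 1963 Thm. 3.1): a compact `C^∞` `(n+1)`-manifold with
  boundary `{τ = 0} = M`, oriented by restriction of an orientation of `Λ`
  (`RegularSublevel.orientation`);
* **`M = ∂V`** (`exists_nullCobordism_smoothOrientation`, **the geometric half of Kirby's VIII
  Thm. 3 for `Q = Sⁿ⁺²`**): the identification `M ≅ ∂V`, `x ↦` the point of `V` over
  `tube (x, 0)`, is a diffeomorphism onto the boundary manifold of the tree's boundary datum
  (`RegularSublevel.boundaryData`, inverse read through `tube⁻¹`; template:
  `PontryaginThomBoundingManifold.lean`), whence a null-cobordism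
  `Literature.Topology.FourManifolds.NullCobordism n M` whose total space carries a smooth orientation.

The analytic half of Kirby's proof — the existence of a datum (a circle map equal to the fibre
angle near `M`, from `[M] = 0`, and a regular value with regular antipode, from Sard's theorem) —
is supplied by the sibling files for simply connected `M`.

## References

* R. C. Kirby, *The Topology of 4-Manifolds*, LNM 1374 (1989), Ch. VIII, Thm. 3 (pp. 44–45) and
  the proof of Thm. 1 (p. 46, "`W₄`"). [Kirby1989]
* A. Juhász, *Differential and Low-Dimensional Topology* (2023), proof of Prop. 4.10.
  [Juhasz2023]
* J. Milnor, *Morse theory* (1963), Thm. 3.1. [Milnor1963]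
* M. W. Hirsch, *Differential Topology* (1976), §4.4 (induced orientations). [HirschDT1976]
-/

open scoped Manifold ContDiff Topology RealInnerProductSpace
open Function Set Filter Literature.Geometry.Manifold

noncomputable section

namespace Literature.Topology.FourManifolds

/-- Local notation: `𝔼 n` is the model Euclidean space `EuclideanSpace ℝ (Fin n)`. -/
local notation "𝔼 " n:arg => EuclideanSpace ℝ (Fin n)

/-- Local notation: `ℍ n` is the model half-space `EuclideanHalfSpace n`. -/
local notation "ℍ " n:arg => EuclideanHalfSpace n

/-- Local notation: `𝕊 n` is the unit sphere in `EuclideanSpace ℝ (Fin (n + 1))`. -/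
local notation "𝕊 " n:arg => (Metric.sphere (0 : EuclideanSpace ℝ (Fin (n + 1))) 1)

-- `Fact (finrank ℝ ℝᵐ⁺¹ = m + 1)`, under which Mathlib charts the round spheres on `ℝᵐ`.
attribute [local instance] fact_finrank_euclideanSpace_succ

namespace SeifertHypersurfaceDatum

open scoped Classical

variable {n : ℕ} {M : Type} [TopologicalSpace M] [ChartedSpace (𝔼 n) M] [CompactSpace M]
  {E : FramedTubularEmbedding n 2 M} (D : SeifertHypersurfaceDatum E)

/-! ### Points of `Λ` in the unit tube -/

/-- **A point of `Λ` in the open unit tube is `tube (x, s v)` with `|s| < 1`**, and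
`s = ⟪fib, v⟫`. [folklore] -/
theorem exists_eq_apply_smul (p : D.Sheet) (h : D.pt p ∈ E.tubeSet 1) :
    ∃ (x : M) (s : ℝ), |s| < 1 ∧ D.pt p = E.tube (x, s • (D.v : 𝔼 2)) ∧
      E.fib (D.pt p) = s • (D.v : 𝔼 2) ∧ ⟪E.fib (D.pt p), (D.v : 𝔼 2)⟫ = s := by
  obtain ⟨⟨x, w⟩, ⟨-, hw⟩, hxw⟩ := h
  have hw1 : ‖w‖ < 1 := by simpa using hw
  have hmem : E.tube (x, w) ∈ D.sheet := by rw [hxw]; exact D.pt_mem_sheet p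
  rw [D.apply_mem_sheet_iff x hw1.le] at hmem
  have hw' := eq_inner_smul_of_inner_quarterRot_eq_zero D.norm_v hmem
  set s := ⟪w, (D.v : 𝔼 2)⟫ with hs
  have hns : ‖w‖ = |s| := by rw [hw', norm_smul, D.norm_v, mul_one, Real.norm_eq_abs]
  refine ⟨x, s, by rwa [← hns], ?_, ?_, ?_⟩
  · rw [← hxw, ← hw']
  · rw [← hxw, E.fib_apply, ← hw']
  · rw [← hxw, E.fib_apply]

/-- `‖s v‖ = |s|`. [folklore] -/
theorem norm_smul_v (s : ℝ) : ‖s • (D.v : 𝔼 2)‖ = |s| := by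
  rw [norm_smul, D.norm_v, mul_one, Real.norm_eq_abs]

/-- `tube (x, s v)` lies on `Λ₀` when `|s| ≤ 1`. [folklore] -/
theorem apply_smul_mem_sheet (x : M) {s : ℝ} (hs : |s| ≤ 1) :
    E.tube (x, s • (D.v : 𝔼 2)) ∈ D.sheet := by
  rw [D.apply_mem_sheet_iff x (by rw [D.norm_smul_v]; exact hs)]
  exact (inner_smul_unit D.norm_v s).2

/-- For `0 < |s| ≤ 1`, `θ (tube (x, s v)) = (s / |s|) v`, so `⟪θ (tube (x, s v)), v⟫ = s / |s|`.
[folklore] -/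
theorem inner_θhat_apply_smul (x : M) {s : ℝ} (hs0 : s ≠ 0) (hs : |s| ≤ 1) :
    ⟪D.θhat (E.tube (x, s • (D.v : 𝔼 2))), (D.v : 𝔼 2)⟫ = |s|⁻¹ * s := by
  have hw : s • (D.v : 𝔼 2) ≠ 0 := smul_ne_zero hs0 D.v_ne_zero
  rw [D.θhat_tube x hw (by rw [D.norm_smul_v]; exact hs), D.norm_smul_v, smul_smul,
    real_inner_smul_left, real_inner_self_eq_norm_sq, D.norm_v]
  ring

/-- For `0 < s ≤ 1`, `θ (tube (x, s v)) = v`. [folklore] -/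
theorem θhat_apply_smul_of_pos (x : M) {s : ℝ} (hs0 : 0 < s) (hs : s ≤ 1) :
    D.θhat (E.tube (x, s • (D.v : 𝔼 2))) = (D.v : 𝔼 2) := by
  have hw : s • (D.v : 𝔼 2) ≠ 0 := smul_ne_zero hs0.ne' D.v_ne_zero
  have hn : ‖s • (D.v : 𝔼 2)‖ = s := by rw [D.norm_smul_v, abs_of_pos hs0]
  rw [D.θhat_tube x hw (by rw [hn]; exact hs), hn, smul_smul, inv_mul_cancel₀ hs0.ne', one_smul]

/-! ### The side function `τ` on `Λ` -/

/-- **The side function** `τ : Λ → ℝ`: `-sat ⟪w, v⟫` in the open unit tube, and `∓1` on the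
sheets `θ⁻¹{±v}` outside it; `{τ ≤ 0} = M ∪ θ⁻¹{v}` and `{τ = 0} = M` (Kirby 1989, proof of
VIII Thm. 3: the half `f_α⁻¹(p) ∪ N` of the closed-up level). [folklore] -/
def sideFn (p : D.Sheet) : ℝ :=
  if D.pt p ∈ E.tubeSet 1 then -sat ⟪E.fib (D.pt p), (D.v : 𝔼 2)⟫
  else if 0 < ⟪D.θhat (D.pt p), (D.v : 𝔼 2)⟫ then -1 else 1

/-- `τ` at a tube point is `-sat ⟪fib, v⟫`. [folklore] -/
theorem sideFn_of_mem_tubeSet {p : D.Sheet} (h : D.pt p ∈ E.tubeSet 1) :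
    D.sideFn p = -sat ⟪E.fib (D.pt p), (D.v : 𝔼 2)⟫ := if_pos h

/-- `τ` off the unit tube is `-1` where `⟪θ, v⟫ > 0`. [folklore] -/
theorem sideFn_of_not_mem_of_pos {p : D.Sheet} (h : D.pt p ∉ E.tubeSet 1)
    (hp : 0 < ⟪D.θhat (D.pt p), (D.v : 𝔼 2)⟫) : D.sideFn p = -1 := by
  rw [sideFn, if_neg h, if_pos hp]

/-- `τ` off the unit tube is `1` where `⟪θ, v⟫ ≤ 0`. [folklore] -/
theorem sideFn_of_not_mem_of_not_pos {p : D.Sheet} (h : D.pt p ∉ E.tubeSet 1)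
    (hp : ¬ 0 < ⟪D.θhat (D.pt p), (D.v : 𝔼 2)⟫) : D.sideFn p = 1 := by
  rw [sideFn, if_neg h, if_neg hp]

/-- **`{τ = 0}` is `M`.** [folklore] -/
theorem sideFn_eq_zero_iff (p : D.Sheet) : D.sideFn p = 0 ↔ D.pt p ∈ range E.emb := by
  by_cases h : D.pt p ∈ E.tubeSet 1
  · obtain ⟨x, s, hs1, hps, -, hin⟩ := D.exists_eq_apply_smul p h
    rw [D.sideFn_of_mem_tubeSet h, hin, neg_eq_zero, sat_eq_zero_iff, hps,
      E.tube_mem_range_emb_iff, smul_eq_zero, or_iff_left D.v_ne_zero]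
  · obtain ⟨hK, -, -⟩ := D.θhat_eq_or_of_not_mem_tubeSet (D.pt_mem_sheet p) h
    simp only [hK, iff_false]
    by_cases hp : 0 < ⟪D.θhat (D.pt p), (D.v : 𝔼 2)⟫
    · rw [D.sideFn_of_not_mem_of_pos h hp]; norm_num
    · rw [D.sideFn_of_not_mem_of_not_pos h hp]; norm_num

/-- **`{τ ≤ 0}` is `M ∪ θ⁻¹{v}`.** [folklore] -/
theorem sideFn_nonpos_iff (p : D.Sheet) :
    D.sideFn p ≤ 0 ↔ D.pt p ∈ range E.emb ∨ D.θhat (D.pt p) = (D.v : 𝔼 2) := by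
  by_cases h : D.pt p ∈ E.tubeSet 1
  · obtain ⟨x, s, hs1, hps, -, hin⟩ := D.exists_eq_apply_smul p h
    rw [D.sideFn_of_mem_tubeSet h, hin, neg_nonpos, sat_nonneg_iff, hps]
    constructor
    · intro hs
      rcases hs.lt_or_eq with hs | hs
      · exact Or.inr (D.θhat_apply_smul_of_pos x hs (le_of_lt (abs_lt.mp hs1).2))
      · left; rw [← hs, zero_smul]; exact ⟨x, rfl⟩
    · rintro (hK | hv)
      · rw [E.tube_mem_range_emb_iff, smul_eq_zero, or_iff_left D.v_ne_zero] at hK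
        rw [hK]
      · by_contra hs
        push Not at hs
        have key := D.inner_θhat_apply_smul x hs.ne hs1.le
        rw [hv, real_inner_self_eq_norm_sq, D.norm_v, abs_of_neg hs, one_pow] at key
        have h2 : (-s)⁻¹ * s = -1 := by rw [inv_neg, neg_mul, inv_mul_cancel₀ hs.ne]
        linarith
  · obtain ⟨hK, -, hθ⟩ := D.θhat_eq_or_of_not_mem_tubeSet (D.pt_mem_sheet p) h
    simp only [hK, false_or]
    by_cases hp : 0 < ⟪D.θhat (D.pt p), (D.v : 𝔼 2)⟫
    · rw [D.sideFn_of_not_mem_of_pos h hp]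
      refine ⟨fun _ => ?_, fun _ => by norm_num⟩
      rcases hθ with hθ | hθ
      · exact hθ
      · rw [hθ, inner_neg_left, real_inner_self_eq_norm_sq, D.norm_v] at hp; norm_num at hp
    · rw [D.sideFn_of_not_mem_of_not_pos h hp]
      refine ⟨fun h1 => by norm_num at h1, fun hv => absurd ?_ hp⟩
      rw [hv, real_inner_self_eq_norm_sq, D.norm_v]; norm_num

/-! ### Smoothness of `τ` -/

/-- The open set `W₊ = (closed tube of radius 3/4)ᶜ ∩ {⟪θ, v⟫ > 0}`. [folklore] -/
def posSet' : Set (𝕊 (n + 2)) :=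
  (E.closedTubeSet (3 / 4))ᶜ ∩ (fun q => ⟪D.θhat q, (D.v : 𝔼 2)⟫) ⁻¹' Ioi 0

/-- The open set `W₋ = (closed tube of radius 3/4)ᶜ ∩ {⟪θ, v⟫ < 0}`. [folklore] -/
def negSet' : Set (𝕊 (n + 2)) :=
  (E.closedTubeSet (3 / 4))ᶜ ∩ (fun q => ⟪D.θhat q, (D.v : 𝔼 2)⟫) ⁻¹' Iio 0

/-- `⟪θ, v⟫` is continuous off the closed tube of radius `3/4`. [folklore] -/
theorem continuousOn_inner_θhat' :
    ContinuousOn (fun q => ⟪D.θhat q, (D.v : 𝔼 2)⟫) (E.closedTubeSet (3 / 4))ᶜ := by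
  have hsub : (E.closedTubeSet (3 / 4))ᶜ ⊆ (range E.emb)ᶜ := by
    refine compl_subset_compl.mpr ?_
    rintro _ ⟨x, rfl⟩
    rw [FramedTubularEmbedding.emb_apply, E.apply_mem_closedTubeSet_iff, norm_zero]
    norm_num
  exact (D.continuousOn_θhat.mono hsub).inner continuousOn_const

/-- `W₊` is open. [folklore] -/
theorem isOpen_posSet' : IsOpen D.posSet' :=
  D.continuousOn_inner_θhat'.isOpen_inter_preimage (E.isClosed_closedTubeSet _).isOpen_compl
    isOpen_Ioi

/-- `W₋` is open. [folklore] -/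
theorem isOpen_negSet' : IsOpen D.negSet' :=
  D.continuousOn_inner_θhat'.isOpen_inter_preimage (E.isClosed_closedTubeSet _).isOpen_compl
    isOpen_Iio

/-- A tube point `tube (x, s v)` of `Λ` outside the closed tube of radius `3/4` has
`3/4 < |s|` and `s ≠ 0`. [folklore] -/
theorem lt_abs_of_not_mem_closedTubeSet {x : M} {s : ℝ}
    (h : E.tube (x, s • (D.v : 𝔼 2)) ∉ E.closedTubeSet (3 / 4)) : 3 / 4 < |s| ∧ s ≠ 0 := by
  rw [E.apply_mem_closedTubeSet_iff, D.norm_smul_v, not_le] at h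
  refine ⟨h, fun h0 => ?_⟩
  rw [h0, abs_zero] at h; norm_num at h

/-- **On `Λ ∩ W₊`, `τ = -1`.** [folklore] -/
theorem sideFn_of_mem_posSet' {p : D.Sheet} (h : D.pt p ∈ D.posSet') : D.sideFn p = -1 := by
  by_cases ht : D.pt p ∈ E.tubeSet 1
  · obtain ⟨x, s, hs1, hps, -, hin⟩ := D.exists_eq_apply_smul p ht
    have h34 : E.tube (x, s • (D.v : 𝔼 2)) ∉ E.closedTubeSet (3 / 4) := by rw [← hps]; exact h.1
    obtain ⟨hs34, hs0⟩ := D.lt_abs_of_not_mem_closedTubeSet h34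
    have hpos : 0 < ⟪D.θhat (D.pt p), (D.v : 𝔼 2)⟫ := h.2
    rw [hps, D.inner_θhat_apply_smul x hs0 hs1.le] at hpos
    have hs : 0 < s := by
      by_contra hs; push Not at hs
      have : |s|⁻¹ * s ≤ 0 := mul_nonpos_of_nonneg_of_nonpos (inv_nonneg.mpr (abs_nonneg s)) hs
      linarith
    rw [abs_of_pos hs] at hs34
    rw [D.sideFn_of_mem_tubeSet ht, hin, sat_of_ge hs34.le]
  · exact D.sideFn_of_not_mem_of_pos ht h.2

/-- **On `Λ ∩ W₋`, `τ = 1`.** [folklore] -/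
theorem sideFn_of_mem_negSet' {p : D.Sheet} (h : D.pt p ∈ D.negSet') : D.sideFn p = 1 := by
  by_cases ht : D.pt p ∈ E.tubeSet 1
  · obtain ⟨x, s, hs1, hps, -, hin⟩ := D.exists_eq_apply_smul p ht
    have h34 : E.tube (x, s • (D.v : 𝔼 2)) ∉ E.closedTubeSet (3 / 4) := by rw [← hps]; exact h.1
    obtain ⟨hs34, hs0⟩ := D.lt_abs_of_not_mem_closedTubeSet h34
    have hneg : ⟪D.θhat (D.pt p), (D.v : 𝔼 2)⟫ < 0 := h.2
    rw [hps, D.inner_θhat_apply_smul x hs0 hs1.le] at hneg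
    have hs : s < 0 := by
      by_contra hs; push Not at hs
      have : 0 ≤ |s|⁻¹ * s := mul_nonneg (inv_nonneg.mpr (abs_nonneg s)) hs
      linarith
    rw [abs_of_neg hs] at hs34
    rw [D.sideFn_of_mem_tubeSet ht, hin, sat_of_le (by linarith)]
    norm_num
  · have hnp : ¬ 0 < ⟪D.θhat (D.pt p), (D.v : 𝔼 2)⟫ := not_lt.mpr (le_of_lt h.2)
    exact D.sideFn_of_not_mem_of_not_pos ht hnp

/-- Off the unit tube a point of `Λ` lies in `W₊ ∪ W₋`. [folklore] -/
theorem mem_posSet'_or_negSet' {p : D.Sheet} (ht : D.pt p ∉ E.tubeSet 1) :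
    D.pt p ∈ D.posSet' ∨ D.pt p ∈ D.negSet' := by
  obtain ⟨-, -, hθ⟩ := D.θhat_eq_or_of_not_mem_tubeSet (D.pt_mem_sheet p) ht
  have h34 : D.pt p ∉ E.closedTubeSet (3 / 4) := by
    intro h'
    obtain ⟨⟨x, w⟩, ⟨-, hw⟩, hxw⟩ := h'
    apply ht
    rw [← hxw, E.apply_mem_tubeSet_iff]
    have : ‖w‖ ≤ 3 / 4 := by simpa using hw
    linarith
  rcases hθ with hv | hv
  · refine Or.inl ⟨h34, ?_⟩
    show 0 < ⟪D.θhat (D.pt p), (D.v : 𝔼 2)⟫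
    rw [hv, real_inner_self_eq_norm_sq, D.norm_v]; norm_num
  · refine Or.inr ⟨h34, ?_⟩
    show ⟪D.θhat (D.pt p), (D.v : 𝔼 2)⟫ < 0
    rw [hv, inner_neg_left, real_inner_self_eq_norm_sq, D.norm_v]; norm_num

/-- **`τ` is smooth on `Λ`.** In the unit tube it is the smooth ambient function `-sat ⟪fib, v⟫`
composed with `pt`; outside it is locally constant (`±1` on `Λ ∩ W∓`). [folklore] -/
theorem contMDiff_sideFn : ContMDiff (𝓡 (n + 1)) 𝓘(ℝ, ℝ) ∞ D.sideFn := by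
  intro p
  by_cases ht : D.pt p ∈ E.tubeSet 1
  · set h : (𝕊 (n + 2)) → ℝ := fun q => -sat ⟪E.fib q, (D.v : 𝔼 2)⟫ with hh
    have hhs : ContMDiffOn (𝓡 (n + 2)) 𝓘(ℝ, ℝ) ∞ h (range E.tube) :=
      ((contDiff_sat.comp (contDiff_id.inner ℝ contDiff_const)).neg.contMDiff).comp_contMDiffOn
        E.contMDiffOn_fib
    have hp : ContMDiffAt (𝓡 (n + 2)) 𝓘(ℝ, ℝ) ∞ h (D.pt p) :=
      hhs.contMDiffAt (E.isOpen_range.mem_nhds (E.tubeSet_subset_range 1 ht))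
    have hcomp : ContMDiffAt (𝓡 (n + 1)) 𝓘(ℝ, ℝ) ∞ (h ∘ D.pt) p := hp.comp p (D.contMDiff_pt p)
    refine hcomp.congr_of_eventuallyEq ?_
    have hopen : IsOpen (D.pt ⁻¹' E.tubeSet 1) := (E.isOpen_tubeSet 1).preimage D.continuous_pt
    filter_upwards [hopen.mem_nhds (show D.pt p ∈ E.tubeSet 1 from ht)] with q hq
    exact D.sideFn_of_mem_tubeSet hq
  · rcases D.mem_posSet'_or_negSet' ht with hmem | hmem
    · refine (contMDiffAt_const (c := (-1 : ℝ))).congr_of_eventuallyEq ?_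
      have hopen : IsOpen (D.pt ⁻¹' D.posSet') := D.isOpen_posSet'.preimage D.continuous_pt
      filter_upwards [hopen.mem_nhds (show D.pt p ∈ D.posSet' from hmem)] with q hq
      exact D.sideFn_of_mem_posSet' hq
    · refine (contMDiffAt_const (c := (1 : ℝ))).congr_of_eventuallyEq ?_
      have hopen : IsOpen (D.pt ⁻¹' D.negSet') := D.isOpen_negSet'.preimage D.continuous_pt
      filter_upwards [hopen.mem_nhds (show D.pt p ∈ D.negSet' from hmem)] with q hq
      exact D.sideFn_of_mem_negSet' hq

/-! ### Regularity of `τ` along `M` -/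

/-- `|sat s / 2| ≤ 1`. [folklore] -/
theorem abs_sat_div_two_le (s : ℝ) : |sat s / 2| ≤ 1 := by
  rw [abs_div, abs_of_pos (by norm_num : (0 : ℝ) < 2)]
  linarith [abs_sat_le s]

/-- **The radial curve** `s ↦ tube (x, (sat s / 2) v)` through the core point `tube (x, 0)`,
with values in `Λ₀` (`|sat s / 2| ≤ 1/2`), as a curve in `Λ`. [folklore] -/
def radialCurve (x : M) (s : ℝ) : D.Sheet :=
  D.toSheet (E.tube (x, (sat s / 2) • (D.v : 𝔼 2))) (D.apply_smul_mem_sheet x (abs_sat_div_two_le s))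

/-- `pt` of the radial curve (definitional). [folklore] -/
@[simp] theorem pt_radialCurve (x : M) (s : ℝ) :
    D.pt (D.radialCurve x s) = E.tube (x, (sat s / 2) • (D.v : 𝔼 2)) := rfl

/-- The radial curve is smooth. [folklore] -/
theorem contMDiff_radialCurve (x : M) : ContMDiff 𝓘(ℝ, ℝ) (𝓡 (n + 1)) ∞ (D.radialCurve x) := by
  refine D.contMDiff_toSheet _ ?_
  have h2 : ContMDiff 𝓘(ℝ, ℝ) 𝓘(ℝ, 𝔼 2) ∞ fun s : ℝ => (sat s / 2) • (D.v : 𝔼 2) :=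
    ((contDiff_sat.div_const 2).smul contDiff_const).contMDiff
  exact E.contMDiff_tube.comp (contMDiff_const.prodMk h2)

/-- Along the radial curve, `τ (γ s) = -s / 2` for `|s| ≤ 1/2`. [folklore] -/
theorem sideFn_radialCurve {x : M} {s : ℝ} (hs : |s| ≤ 1 / 2) :
    D.sideFn (D.radialCurve x s) = -(s / 2) := by
  have hsat : sat s = s := sat_of_abs_le hs
  have hmem : D.pt (D.radialCurve x s) ∈ E.tubeSet 1 := by
    rw [pt_radialCurve, E.apply_mem_tubeSet_iff, D.norm_smul_v, hsat, abs_div,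
      abs_of_pos (by norm_num : (0 : ℝ) < 2)]
    linarith
  rw [D.sideFn_of_mem_tubeSet hmem, pt_radialCurve, E.fib_apply, (inner_smul_unit D.norm_v _).1,
    hsat, sat_of_abs_le]
  rw [abs_div, abs_of_pos (by norm_num : (0 : ℝ) < 2)]
  linarith

/-- **`0` is a regular value of `τ`**: at a point of `Λ` on the core, `dτ ≠ 0` — along the
radial curve `τ` is `s ↦ -s/2`, whose derivative is `-1/2`. [folklore] -/
theorem not_isMCriticalPt_sideFn (p : D.Sheet) (hp : D.sideFn p = 0) :
    ¬ IsMCriticalPt (𝓡 (n + 1)) D.sideFn p := by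
  intro hcrit
  obtain ⟨x, hx⟩ : D.pt p ∈ range E.emb := (D.sideFn_eq_zero_iff p).mp hp
  -- `p = γ 0`
  have hγ0 : D.radialCurve x 0 = p := by
    apply D.pt_injective
    rw [pt_radialCurve, sat_eq_zero_iff.mpr rfl, zero_div, zero_smul, ← hx,
      FramedTubularEmbedding.emb_apply]
  have hγd : MDifferentiableAt 𝓘(ℝ, ℝ) (𝓡 (n + 1)) (D.radialCurve x) 0 :=
    (D.contMDiff_radialCurve x 0).mdifferentiableAt (by simp)
  have hτd : MDifferentiableAt (𝓡 (n + 1)) 𝓘(ℝ, ℝ) D.sideFn (D.radialCurve x 0) :=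
    (D.contMDiff_sideFn _).mdifferentiableAt (by simp)
  -- the composite has vanishing derivative …
  have hA : mfderiv 𝓘(ℝ, ℝ) 𝓘(ℝ, ℝ) (D.sideFn ∘ D.radialCurve x) 0 (1 : ℝ) = 0 := by
    rw [mfderiv_comp 0 hτd hγd]
    have : mfderiv (𝓡 (n + 1)) 𝓘(ℝ, ℝ) D.sideFn (D.radialCurve x 0) = 0 := by
      rw [hγ0]; exact hcrit
    rw [this]
    rfl
  -- … but equals `s ↦ -s/2` near `0`
  have heq : (D.sideFn ∘ D.radialCurve x) =ᶠ[𝓝 0] fun s : ℝ => -(s / 2) := by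
    have hI : Ioo (-(1 / 2) : ℝ) (1 / 2) ∈ 𝓝 (0 : ℝ) := Ioo_mem_nhds (by norm_num) (by norm_num)
    filter_upwards [hI] with s hs
    exact D.sideFn_radialCurve (abs_le.mpr ⟨hs.1.le, hs.2.le⟩)
  have hB : (mfderiv 𝓘(ℝ, ℝ) 𝓘(ℝ, ℝ) (fun s : ℝ => -(s / 2)) 0 (1 : ℝ) : ℝ) = -(1 / 2 : ℝ) := by
    rw [mfderiv_eq_fderiv]
    show deriv (fun s : ℝ => -(s / 2)) 0 = -(1 / 2 : ℝ)
    exact (((hasDerivAt_id (0 : ℝ)).div_const 2).neg).deriv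
  have hAB := congrFun (congrArg DFunLike.coe
    (heq.mfderiv_eq (I := 𝓘(ℝ, ℝ)) (I' := 𝓘(ℝ, ℝ)))) (1 : ℝ)
  have : (-(1 / 2) : ℝ) = 0 := hB.symm.trans (hAB.symm.trans hA)
  norm_num at this

/-- Every point of `Λ` is an interior point (a manifold without boundary). [folklore] -/
theorem isInteriorPoint_sheet (p : D.Sheet) : (𝓡 (n + 1)).IsInteriorPoint p :=
  BoundarylessManifold.isInteriorPoint

/-- **`0` is a regular level of `τ : Λ → ℝ`** (the tree's `IsRegularLevel`). [folklore] -/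
theorem isRegularLevel_sideFn : IsRegularLevel (𝓡 (n + 1)) D.sideFn 0 :=
  ⟨D.contMDiff_sideFn, fun p _ => D.isInteriorPoint_sheet p,
    fun p hp => D.not_isMCriticalPt_sideFn p hp⟩

/-! ### The Seifert hypersurface `V = {τ ≤ 0} = M ∪ θ⁻¹{v}` -/

/-- **The Seifert hypersurface `V = {τ ≤ 0} = M ∪ θ⁻¹{v}`** as a type: the regular sublevel set
of `τ` in the closed manifold `Λ` (the tree's `RegularSublevel`, Milnor 1963 Thm. 3.1) — a compact
`C^∞` `(n+1)`-manifold with boundary (charts in `EuclideanHalfSpace (n + 1)`, model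
`𝓡∂ (n + 1)`), Kirby's `V = f_α⁻¹(p) ∪ N` (1989, proof of VIII Thm. 3).
[cite: Kirby1989, Ch. VIII, proof of Thm. 3 (p. 45)] -/
abbrev Hypersurface (D : SeifertHypersurfaceDatum E) : Type :=
  RegularSublevel (k := n) D.isRegularLevel_sideFn

/-- The point of `Λ` under a point of `V`. [folklore] -/
abbrev hypPt (p : D.Hypersurface) : D.Sheet := RegularSublevel.incl (k := n) D.isRegularLevel_sideFn p

/-- **Boundary points of `V` are the points over the core `M`.** [cite: Milnor1963, Thm. 3.1] -/
theorem mem_boundary_hypersurface_iff (p : D.Hypersurface) :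
    p ∈ (𝓡∂ (n + 1)).boundary D.Hypersurface ↔ D.pt (D.hypPt p) ∈ range E.emb := by
  rw [RegularSublevel.mem_boundary_iff (k := n) D.isRegularLevel_sideFn p, ← D.sideFn_eq_zero_iff]

/-- **`V` is smoothly oriented**: an orientation of the orientable closed hypersurface `Λ`
(`isOrientable_sheet`) restricts to the regular sublevel set `V` (`RegularSublevel.orientation`,
Hirsch 1976 §4.4; Kirby 1989, proof of VIII Thm. 3: "`V` is orientable").
[cite: HirschDT1976, §4.4 p. 101] -/
theorem nonempty_smoothOrientation_hypersurface :
    Nonempty (SmoothOrientation (𝓡∂ (n + 1)) D.Hypersurface) :=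
  RegularSublevel.isOrientable (k := n) D.isRegularLevel_sideFn D.isOrientable_sheet

/-! ### The core as the boundary of `V` -/

/-- **The point of `V` over the core point `tube (x, 0)`.** [folklore] -/
def corePt (x : M) : D.Hypersurface :=
  RegularSublevel.mk (k := n) D.isRegularLevel_sideFn
    (D.toSheet (E.emb x) (D.range_emb_subset_sheet (mem_range_self x)))
    (le_of_eq ((D.sideFn_eq_zero_iff _).2 (mem_range_self x)))

/-- `pt (hypPt (corePt x)) = tube (x, 0)` (definitional). [folklore] -/
@[simp] theorem pt_hypPt_corePt (x : M) : D.pt (D.hypPt (D.corePt x)) = E.emb x := rfl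

/-- Core points are boundary points of `V`. [folklore] -/
theorem corePt_mem_boundary (x : M) : D.corePt x ∈ (𝓡∂ (n + 1)).boundary D.Hypersurface :=
  (D.mem_boundary_hypersurface_iff _).2 (mem_range_self x)

/-- `corePt` is continuous. [folklore] -/
theorem continuous_corePt : Continuous D.corePt :=
  (D.contMDiff_toSheet (fun x => D.range_emb_subset_sheet (mem_range_self x))
    E.contMDiff_emb).continuous.subtype_mk _

/-- **`corePt : M → V` is smooth** (universal property of the immersion `V ↪ Λ`,
`ContMDiff.iff_comp_isImmersion`). [cite: LeeSmoothManifolds2013, Cor. 5.30] -/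
theorem contMDiff_corePt [IsManifold (𝓡 n) ∞ M] : ContMDiff (𝓡 n) (𝓡∂ (n + 1)) ∞ D.corePt :=
  (ContMDiff.iff_comp_isImmersion
    (RegularSublevel.isSmoothEmbedding_incl (k := n) D.isRegularLevel_sideFn).isImmersion).2
    ⟨D.continuous_corePt, D.contMDiff_toSheet (fun x => D.range_emb_subset_sheet (mem_range_self x))
      E.contMDiff_emb⟩

/-- `corePt` is injective. [folklore] -/
theorem corePt_injective : Injective D.corePt := fun x y h => by
  have h1 : E.emb x = E.emb y := by rw [← D.pt_hypPt_corePt x, ← D.pt_hypPt_corePt y, h]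
  simpa using E.injective_tube h1

/-! ### `M = ∂V`: the null-cobordism -/

/-- **`M ≅ ∂V` and the null-cobordism `M = ∂V` with `V` smoothly oriented — the geometric half of
Kirby's VIII Thm. 3 for `Q = Sⁿ⁺²`.**  Given a Seifert hypersurface datum of a codimension-two
framed tubular embedding of the compact `n`-manifold `M` into `Sⁿ⁺²` (a circle map of the
complement equal to the fibre angle near `M`, and a regular value with regular antipode), `M` is
the boundary of a compact `C^∞` `(n+1)`-manifold `V` carrying a smooth orientation: `V = {τ ≤ 0}`
in `Λ = M ∪ θ⁻¹{±v}`, i.e. Kirby's `V = f_α⁻¹(p) ∪ N`, the identification `M ≅ ∂V` being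
`x ↦ tube (x, 0)` with inverse read through `tube⁻¹` (a diffeomorphism onto the boundary manifold
of `RegularSublevel.boundaryData`).  Kirby 1989, VIII Thm. 3 (pp. 44–45: "`N` bounds a compact
`Vⁿ⁺¹ ⊂ Q` … `V = f⁻¹(p)` … orientable"), used on p. 46 for `W₄`.
[cite: Kirby1989, Ch. VIII, Thm. 3 (pp. 44–45)] -/
theorem exists_nullCobordism_smoothOrientation [IsManifold (𝓡 n) ∞ M]
    (D : SeifertHypersurfaceDatum E) :
    ∃ c : NullCobordism.{0} n M, Nonempty (SmoothOrientation (𝓡∂ (n + 1)) c.W) := by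
  set hτ := D.isRegularLevel_sideFn with hhτ
  set b := RegularSublevel.boundaryData (k := n) hτ with hb
  -- the map `M → ∂V`
  set φf : M → b.carrier := fun x => ⟨D.corePt x, D.corePt_mem_boundary x⟩ with hφf
  have hφfc : Continuous φf := D.continuous_corePt.subtype_mk _
  have hφfsm : ContMDiff (𝓡 n) (𝓡 n) ∞ φf :=
    (ContMDiff.iff_comp_isImmersion b.isSmoothEmbedding.isImmersion).2 ⟨hφfc, D.contMDiff_corePt⟩
  -- boundary points sit over the core
  have hbd : ∀ c : b.carrier, ∃ x : M, D.pt (D.hypPt c.1) = E.emb x := fun c => by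
    obtain ⟨x, hx⟩ := (D.mem_boundary_hypersurface_iff c.1).1 c.2
    exact ⟨x, hx.symm⟩
  have hφf_of : ∀ (c : b.carrier) (x : M), D.pt (D.hypPt c.1) = E.emb x → φf x = c := by
    intro c x hx
    apply Subtype.ext
    apply RegularSublevel.injective_incl (k := n) hτ
    apply D.pt_injective
    exact hx.symm
  rcases isEmpty_or_nonempty M with hM | hM
  · -- empty core: the boundary is empty and `φf` is trivially a diffeomorphism
    have hbe : IsEmpty b.carrier := ⟨fun c => by obtain ⟨x, -⟩ := hbd c; exact hM.elim x⟩
    let Φ : M ≃ₘ^∞⟮𝓡 n, 𝓡 n⟯ b.carrier :=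
      { toFun := φf
        invFun := fun c => hbe.elim c
        left_inv := fun x => hM.elim x
        right_inv := fun c => hbe.elim c
        contMDiff_toFun := hφfsm
        contMDiff_invFun := fun c => hbe.elim c }
    refine ⟨{ W := D.Hypersurface
              incl := b.incl ∘ Φ
              isSmoothEmbedding_incl := b.isSmoothEmbedding.comp_diffeomorph Φ
              range_incl := ?_ }, D.nonempty_smoothOrientation_hypersurface⟩
    have hΦs : Function.Surjective Φ := fun c => hbe.elim c
    rw [range_comp, hΦs.range_eq, image_univ]
    exact b.range_incl
  · -- the inverse `∂V → M`: read the tube coordinate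
    haveI : Nonempty (M × 𝔼 2) := ⟨(Classical.choice hM, 0)⟩
    set P : 𝕊 (n + 2) → M := fun p => (invFun E.tube p).1 with hP
    have hPsm : ContMDiffOn (𝓡 (n + 2)) (𝓡 n) ∞ P (range E.tube) :=
      contMDiff_fst.comp_contMDiffOn (contMDiffOn_invFun_range E.isSmoothEmbedding)
    have hPemb : ∀ x, P (E.emb x) = x := fun x => by
      rw [hP, FramedTubularEmbedding.emb_apply]
      simp only
      rw [leftInverse_invFun E.injective_tube]
    set ψ : b.carrier → M := fun c => P (D.pt (D.hypPt c.1)) with hψ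
    have hψsm : ContMDiff (𝓡 n) (𝓡 n) ∞ ψ := by
      refine hPsm.comp_contMDiff (D.contMDiff_pt.comp
        ((RegularSublevel.contMDiff_incl (k := n) hτ).comp b.isSmoothEmbedding.contMDiff))
        fun c => ?_
      obtain ⟨x, hx⟩ := hbd c
      show D.pt (D.hypPt c.1) ∈ range E.tube
      rw [hx, FramedTubularEmbedding.emb_apply]
      exact mem_range_self _
    have hleft : ∀ x, ψ (φf x) = x := fun x => by
      show P (D.pt (D.hypPt (D.corePt x))) = x
      rw [D.pt_hypPt_corePt, hPemb]
    have hright : ∀ c, φf (ψ c) = c := fun c => by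
      obtain ⟨x, hx⟩ := hbd c
      have hψc : ψ c = x := by
        show P (D.pt (D.hypPt c.1)) = x
        rw [hx, hPemb]
      rw [hψc]
      exact hφf_of c x hx
    let Φ : M ≃ₘ^∞⟮𝓡 n, 𝓡 n⟯ b.carrier :=
      { toFun := φf
        invFun := ψ
        left_inv := hleft
        right_inv := hright
        contMDiff_toFun := hφfsm
        contMDiff_invFun := hψsm }
    refine ⟨{ W := D.Hypersurface
              incl := b.incl ∘ Φ
              isSmoothEmbedding_incl := b.isSmoothEmbedding.comp_diffeomorph Φ
              range_incl := ?_ }, D.nonempty_smoothOrientation_hypersurface⟩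
    have hΦs : Function.Surjective Φ := fun c => ⟨ψ c, hright c⟩
    rw [range_comp, hΦs.range_eq, image_univ]
    exact b.range_incl

end SeifertHypersurfaceDatum

/-- **Kirby's VIII Thm. 3 (geometric half), stated without the datum namespace.**  If a compact
`n`-manifold `M` with a codimension-two framed tubular embedding `E` into `Sⁿ⁺²` admits a Seifert
hypersurface datum (a smooth circle map of the complement of the core equal to the fibre angle
near the core, and a regular value with regular antipode), then `M` bounds a compact smoothly
oriented `(n+1)`-manifold. [cite: Kirby1989, Ch. VIII, Thm. 3 (pp. 44–45)] -/
theorem FramedTubularEmbedding.exists_nullCobordism_smoothOrientation_of_datum {n : ℕ} {M : Type}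
    [TopologicalSpace M] [ChartedSpace (𝔼 n) M] [CompactSpace M] [IsManifold (𝓡 n) ∞ M]
    (E : FramedTubularEmbedding n 2 M) (hD : Nonempty (SeifertHypersurfaceDatum E)) :
    ∃ c : NullCobordism.{0} n M, Nonempty (SmoothOrientation (𝓡∂ (n + 1)) c.W) :=
  hD.some.exists_nullCobordism_smoothOrientation

end Literature.Topology.FourManifolds
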